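import Literature.NumberTheory.LFunctions.WeilTwoPrimeDeflL2Base
import Literature.NumberTheory.LFunctions.WeilBlockRowsPZ
import HarnessLib

/-!
# Deflated two-prime certificate L2: the factored even inverse agrees with `D`, rows 80–87

`WeilCert.checkDnRow` (even block) for certificate L2, by `decide +kernel`. Pure proof file.
-/

noncomputable section

namespace Literature.NumberTheory.LFunctions

set_option maxHeartbeats 0 in
/-- Row 80 of `DnE/LsE` is row 80 of the even `D` (certificate L2). [folklore] -/
theorem checkDnRow0_80_weilCertDeflL2 : weilCertDeflL2Base.checkDnRow weilCertDeflL2DnE weilCertDeflL2LsE 0 80 = true := by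
  decide +kernel

set_option maxHeartbeats 0 in
/-- Row 81 of `DnE/LsE` is row 81 of the even `D` (certificate L2). [folklore] -/
theorem checkDnRow0_81_weilCertDeflL2 : weilCertDeflL2Base.checkDnRow weilCertDeflL2DnE weilCertDeflL2LsE 0 81 = true := by
  decide +kernel

set_option maxHeartbeats 0 in
/-- Row 82 of `DnE/LsE` is row 82 of the even `D` (certificate L2). [folklore] -/
theorem checkDnRow0_82_weilCertDeflL2 : weilCertDeflL2Base.checkDnRow weilCertDeflL2DnE weilCertDeflL2LsE 0 82 = true := by
  decide +kernel

set_option maxHeartbeats 0 in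
/-- Row 83 of `DnE/LsE` is row 83 of the even `D` (certificate L2). [folklore] -/
theorem checkDnRow0_83_weilCertDeflL2 : weilCertDeflL2Base.checkDnRow weilCertDeflL2DnE weilCertDeflL2LsE 0 83 = true := by
  decide +kernel

set_option maxHeartbeats 0 in
/-- Row 84 of `DnE/LsE` is row 84 of the even `D` (certificate L2). [folklore] -/
theorem checkDnRow0_84_weilCertDeflL2 : weilCertDeflL2Base.checkDnRow weilCertDeflL2DnE weilCertDeflL2LsE 0 84 = true := by
  decide +kernel

set_option maxHeartbeats 0 in
/-- Row 85 of `DnE/LsE` is row 85 of the even `D` (certificate L2). [folklore] -/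
theorem checkDnRow0_85_weilCertDeflL2 : weilCertDeflL2Base.checkDnRow weilCertDeflL2DnE weilCertDeflL2LsE 0 85 = true := by
  decide +kernel

set_option maxHeartbeats 0 in
/-- Row 86 of `DnE/LsE` is row 86 of the even `D` (certificate L2). [folklore] -/
theorem checkDnRow0_86_weilCertDeflL2 : weilCertDeflL2Base.checkDnRow weilCertDeflL2DnE weilCertDeflL2LsE 0 86 = true := by
  decide +kernel

set_option maxHeartbeats 0 in
/-- Row 87 of `DnE/LsE` is row 87 of the even `D` (certificate L2). [folklore] -/
theorem checkDnRow0_87_weilCertDeflL2 : weilCertDeflL2Base.checkDnRow weilCertDeflL2DnE weilCertDeflL2LsE 0 87 = true := by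
  decide +kernel


end Literature.NumberTheory.LFunctions
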